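import Literature.NumberTheory.GaloisCohomology.Howard2004.DVRSettingPiRefinementRings
import Literature.NumberTheory.GaloisCohomology.Howard2004.DVRSettingPiRefinement
import HarnessLib

/-!
# Howard 2004, §1.6 with Rem. 1.3.1: the residual data of the `π`-adic refinement of a `DVRSetting`
# (`T/π^jT ↠ T̄`, H.1, the `G_ℚ`-structure `θ` and H.5(a) over the level rings `R/π^j`)
# (definitions with bodies + theorems)

B. Howard, *The Heegner point Kolyvagin system*, Compositio Math. **140** (2004) (arXiv:1202.6340): H.1 «`T̄ =
T/𝔪T` is absolutely irreducible» (p. 7 L59), H.5(a) «the action of `G_K` on `T̄` extends to an action of `G_ℚ`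
and `τ` splits `T̄ = T̄⁺ ⊕ T̄⁻`» (p. 7 L93–95); Rem. 1.3.1 (p. 7 L125–127): stable under base change; §1.6
(p. 11 L33–38): imposed on every `T^{(k)} = T/𝔪^kT`.  Brick (R2b) of the refinement constructor (REFINE, cell
`pub/bsd-print-x9`; R1 `DVRSettingPiRefinement`, R2a `DVRSettingPiRefinementRings`).  The residual
representation `T̄` of the refined setting is THE SAME `S.ρbar` on the same carrier `Nbar`; what changes is the
ring through which the scalars act (`R/π^{i+1}` instead of `R_k`), and the presentations `T/π^{i+1}T ↠ T̄`.

* §1 the scalar action of `R` on `T̄` through the level rings is level-independent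
  (`algebraMap_smul_residual_eq`) and `𝔪` acts by zero (`algebraMap_smul_residual_eq_zero_of_mem`);
* §2 **`DVRSetting.residualModule S hy i : Module (S.QuotRing (i+1)) Nbar`** (a reducible def to be bound with
  `letI` — the refined setting's `[∀ i, Module (Rk♯ i) Nbar]`; built from `Module.compHom` through `R_0` and
  `Module.IsTorsionBySet.module`), with `mk_smul_residual : ⟦r⟧ • x = algebraMap R (Rk k) r • x` for EVERY `k`;
  `isScalarLinear_modIdeal_quotRing` (the action on `T^{(k)}/π^jT^{(k)}` is `R/π^j`-linear);
* §3 **`DVRSetting.levelToResidual S hy (h : i+1 ≤ e_k) : (T^{(k)}/π^{i+1}) →ₗ[R/π^{i+1}] T̄`** descending `π̄_k`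
  (`levelToResidual_mk`), onto, with kernel `𝔪_{R/π^{i+1}} · (T^{(k)}/π^{i+1})`, equivariant:
  **`isQuotientBy_levelToResidual`** (the H.1 presentation of the refined level);
* §4 **H.1 for the refined levels** `h1_quotLevel` (irreducibility and Schur transported along the common
  carrier: submodules / endomorphisms over `R/π^{i+1}` are submodules / endomorphisms over `R_k`);
* §5 **`DVRSetting.residualTauQuot S hy i : ResidualTau (R := S.QuotRing (i+1)) S.cd S.ρbar`** (`θ` of level `0`
  re-based; `θ_eq_zero`: all the `θ_k` agree), `residualTauQuot_θ`, **H.5(a)♯** `h5a_residualTauQuot`.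

Definitions with bodies and theorems only: no named fact, no instance, no notation, no `sorry`.  H.5(b)/(c) of
the refined levels are NOT here (R3/R4).  `thm161_dvrKolyvaginBound` is NOT proved; BSD is not proved by any of this.
-/

set_option autoImplicit false

noncomputable section

open Function NumberField IsDedekindDomain Field
open scoped NumberField ContRepresentation Classical

namespace Literature.NumberTheory.GaloisCohomology.Howard2004

open Literature.NumberTheory.GaloisRepresentations
open Literature.NumberTheory.GaloisRepresentations.DiscreteGaloisModule

namespace DVRSetting

variable {p : ℕ} [Fact p.Prime] {K : Type} [Field K] [NumberField K]
  {R : Type} [CommRing R] [IsDomain R] [IsDiscreteValuationRing R] [Algebra ℤ_[p] R]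
  {N : ℕ → Type} [∀ k, AddCommGroup (N k)] [∀ k, TopologicalSpace (N k)]
  [∀ k, DiscreteTopology (N k)] [∀ k, Module R (N k)]
  {Rk : ℕ → Type} [∀ k, CommRing (Rk k)] [∀ k, IsLocalRing (Rk k)] [∀ k, TopologicalSpace (Rk k)]
  [∀ k, DiscreteTopology (Rk k)] [∀ k, Algebra ℤ_[p] (Rk k)] [∀ k, Algebra R (Rk k)]
  [∀ k, Module (Rk k) (N k)] [∀ k, IsScalarTower R (Rk k) (N k)]
  {Nbar : Type} [AddCommGroup Nbar] [TopologicalSpace Nbar] [DiscreteTopology Nbar]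
  [∀ k, Module (Rk k) Nbar]
  {Nq : ℕ → Finset (HeightOneSpectrum (𝓞 K)) → Type} [∀ k n, AddCommGroup (Nq k n)]
  [∀ k n, TopologicalSpace (Nq k n)] [∀ k n, DiscreteTopology (Nq k n)]
  [∀ k n, Module (Rk k) (Nq k n)] [∀ k n, Module R (Nq k n)]
  [∀ k n, IsScalarTower R (Rk k) (Nq k n)]

/-! ## §1 The action of `R` on `T̄` through the level rings -/

/-- One step: `R` acts on `T̄` identically through `R_k` and `R_{k+1}` (`π̄_k ∘ red_k = π̄_{k+1}`, both `π̄`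
linear, `red` `R`-linear). [cite: Howard2004HeegnerKolyvagin, H.1 and §1.6 (arXiv p. 7 L59, p. 11 L33–38)] -/
theorem algebraMap_smul_residual_eq_succ (S : DVRSetting p K R N Rk Nbar Nq) (hy : S.SatisfiesH) (k : ℕ)
    (r : R) (x : Nbar) : algebraMap R (Rk k) r • x = algebraMap R (Rk (k + 1)) r • x := by
  obtain ⟨y, rfl⟩ := (hy.h1 (k + 1)).1.surjective x
  have hl : algebraMap R (Rk k) r • S.πbar (k + 1) y = S.πbar (k + 1) (r • y) := by
    rw [← hy.πbar_red, ← (S.πbar k).map_smul, algebraMap_smul, ← (S.T.red k).map_smul, hy.πbar_red]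
  have hr : algebraMap R (Rk (k + 1)) r • S.πbar (k + 1) y = S.πbar (k + 1) (r • y) := by
    rw [← (S.πbar (k + 1)).map_smul, algebraMap_smul]
  rw [hl, hr]

/-- **The scalar action of `R` on `T̄` through the level rings is level-independent.**
[cite: Howard2004HeegnerKolyvagin, H.1 and §1.6 (arXiv p. 7 L59, p. 11 L33–38)] -/
theorem algebraMap_smul_residual_eq (S : DVRSetting p K R N Rk Nbar Nq) (hy : S.SatisfiesH) (k k' : ℕ)
    (r : R) (x : Nbar) : algebraMap R (Rk k) r • x = algebraMap R (Rk k') r • x := by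
  suffices h : ∀ j, algebraMap R (Rk j) r • x = algebraMap R (Rk 0) r • x by rw [h k, h k']
  intro j
  induction j with
  | zero => rfl
  | succ j ih => rw [← S.algebraMap_smul_residual_eq_succ hy j, ih]

/-- `algebraMap R R_k π` is not a unit (`π^{e_k} ↦ 0`, `R_k ≠ 0`). [cite: Howard2004HeegnerKolyvagin, §1.6 (arXiv p. 11, L33–34)] -/
theorem algebraMap_pi_mem_maximalIdeal (S : DVRSetting p K R N Rk Nbar Nq) (hy : S.SatisfiesH) (k : ℕ) :
    algebraMap R (Rk k) S.π ∈ IsLocalRing.maximalIdeal (Rk k) := by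
  rw [IsLocalRing.mem_maximalIdeal, mem_nonunits_iff]
  intro hu
  have h0 : algebraMap R (Rk k) S.π ^ S.e k = 0 := by
    rw [← map_pow, ← RingHom.mem_ker, hy.ker_algebraMap, hy.unif, Ideal.span_singleton_pow]
    exact Ideal.mem_span_singleton_self _
  exact not_isUnit_zero (h0 ▸ hu.pow (S.e k))

/-- **`𝔪 · T̄ = 0`**: an element of `𝔪 ⊆ R` acts by zero on `T̄` through any level ring.
[cite: Howard2004HeegnerKolyvagin, H.1 (arXiv p. 7, L59: «`T̄ = T/𝔪T`»)] -/
theorem algebraMap_smul_residual_eq_zero_of_mem (S : DVRSetting p K R N Rk Nbar Nq) (hy : S.SatisfiesH) (k : ℕ)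
    {r : R} (hr : r ∈ IsLocalRing.maximalIdeal R) (x : Nbar) : algebraMap R (Rk k) r • x = 0 := by
  obtain ⟨hq, -, -, -⟩ := hy.h1 k
  obtain ⟨y, rfl⟩ := hq.surjective x
  rw [hy.unif, Ideal.mem_span_singleton'] at hr
  obtain ⟨a, rfl⟩ := hr
  rw [← LinearMap.map_smul, ← LinearMap.mem_ker, hq.ker_eq, map_mul, mul_smul]
  exact Submodule.smul_mem _ _ (Submodule.smul_mem_smul (S.algebraMap_pi_mem_maximalIdeal hy k) Submodule.mem_top)

/-- `π · T̄ = 0` through any level ring (private twin of `ResidualLevelControlProofs`'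
`algebraMap_pi_smul_residual_eq_zero`, not imported to keep this file light). [cite: Howard2004HeegnerKolyvagin, H.1 (arXiv p. 7, L59)] -/
private theorem maximalIdeal_smul_residual_eq_zero_aux (S : DVRSetting p K R N Rk Nbar Nq) (hy : S.SatisfiesH) (k : ℕ)
    (x : Nbar) : algebraMap R (Rk k) S.π • x = 0 :=
  S.algebraMap_smul_residual_eq_zero_of_mem hy k (by rw [hy.unif]; exact Ideal.mem_span_singleton_self _) x

/-! ## §2 `T̄` as a module over the level rings `R/π^{i+1}` of the refinement -/

/-- `(π^{i+1})` acts by zero on `T̄` (through `R → R_0`). [cite: Howard2004HeegnerKolyvagin, H.1 (arXiv p. 7, L59)] -/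
theorem residual_isTorsionBySet (S : DVRSetting p K R N Rk Nbar Nq) (hy : S.SatisfiesH) (i : ℕ) :
    letI : Module R Nbar := Module.compHom Nbar (algebraMap R (Rk 0))
    Module.IsTorsionBySet R Nbar (Ideal.span {S.π ^ (i + 1)} : Set R) := by
  letI : Module R Nbar := Module.compHom Nbar (algebraMap R (Rk 0))
  rintro x ⟨a, ha⟩
  have ha' : a ∈ IsLocalRing.maximalIdeal R := by
    rw [hy.unif]
    exact Ideal.span_singleton_le_span_singleton.mpr (dvd_pow_self S.π (Nat.succ_ne_zero i)) ha
  exact S.algebraMap_smul_residual_eq_zero_of_mem hy 0 ha' x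

/-- **`T̄` as a module over the level ring `R/π^{i+1}` of the refinement** (the refined setting's
`Module (Rk♯ i) Nbar`; reducible, to be bound with `letI` — no instance is declared): `⟦r⟧ • x := r • x` through
any level ring. [cite: Howard2004HeegnerKolyvagin, H.1 with Rem. 1.3.1 and §1.6 (arXiv p. 7 L59 and L125–127, p. 11 L33–38)] -/
@[reducible] def residualModule (S : DVRSetting p K R N Rk Nbar Nq) (hy : S.SatisfiesH) (i : ℕ) :
    Module (S.QuotRing (i + 1)) Nbar :=
  letI : Module R Nbar := Module.compHom Nbar (algebraMap R (Rk 0))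
  (S.residual_isTorsionBySet hy i).module

/-- Unfolding the action: `⟦r⟧ • x = algebraMap R R_k r • x` for EVERY level `k`.
[cite: Howard2004HeegnerKolyvagin, H.1 and §1.6 (arXiv p. 7 L59, p. 11 L33–38)] -/
theorem mk_smul_residual (S : DVRSetting p K R N Rk Nbar Nq) (hy : S.SatisfiesH) (i k : ℕ) (r : R) (x : Nbar) :
    letI := S.residualModule hy i
    (Ideal.Quotient.mk (Ideal.span {S.π ^ (i + 1)}) r) • x = algebraMap R (Rk k) r • x := by
  letI : Module R Nbar := Module.compHom Nbar (algebraMap R (Rk 0))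
  change algebraMap R (Rk 0) r • x = _
  exact S.algebraMap_smul_residual_eq hy 0 k r x

/-- **The action on `T^{(k)}/π^jT^{(k)}` is `R/π^j`-linear** (scalars of `R/π^j` act through representatives;
with `k = host j` this is the refined setting's `scalarLinear♯`, `D.levelRep j` being this `modIdeal` by `rfl`).
[cite: Howard2004HeegnerKolyvagin, §1 conventions and Def. 1.1.3 (arXiv p. 5 L3–24 and L93–99)] -/
theorem isScalarLinear_modIdeal_quotRing (S : DVRSetting p K R N Rk Nbar Nq) (j k : ℕ) :
    (modIdeal (S.T.ρ k) (S.T.hlin k) (Ideal.span {S.π ^ j})).IsScalarLinear (S.QuotRing j) := by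
  intro σ c q
  obtain ⟨r, rfl⟩ := Ideal.Quotient.mk_surjective c
  obtain ⟨y, rfl⟩ := Submodule.mkQ_surjective _ q
  change modIdeal (S.T.ρ k) (S.T.hlin k) _ σ (Submodule.Quotient.mk (r • y)) =
    (Ideal.Quotient.mk _ r) • modIdeal (S.T.ρ k) (S.T.hlin k) _ σ (Submodule.Quotient.mk y)
  rw [modIdeal_apply_mk, modIdeal_apply_mk, S.T.hlin k σ r y]
  rfl

/-! ## §3 The presentations `T/π^{i+1}T ↠ T̄` -/

/-- `π̄_k` as an `R`-linear map for the `R`-structure of `T̄` through `R_0`. [cite: Howard2004HeegnerKolyvagin, H.1 (arXiv p. 7, L59)] -/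
@[reducible] def πbarR (S : DVRSetting p K R N Rk Nbar Nq) (hy : S.SatisfiesH) (k : ℕ) :
    letI : Module R Nbar := Module.compHom Nbar (algebraMap R (Rk 0))
    N k →ₗ[R] Nbar :=
  letI : Module R Nbar := Module.compHom Nbar (algebraMap R (Rk 0))
  { toFun := S.πbar k
    map_add' := fun x y => map_add _ x y
    map_smul' := fun r y => by
      change S.πbar k (r • y) = algebraMap R (Rk 0) r • S.πbar k y
      rw [← algebraMap_smul (Rk k) r y, LinearMap.map_smul, S.algebraMap_smul_residual_eq hy k 0] }

/-- `π^{i+1} T^{(k)} ⊆ ker π̄_k` (indeed `ker π̄_k = 𝔪 T^{(k)} ⊇ π T^{(k)}`). [cite: Howard2004HeegnerKolyvagin, H.1 (arXiv p. 7, L59)] -/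
theorem span_pi_pow_smul_top_le_ker_πbar (S : DVRSetting p K R N Rk Nbar Nq) (hy : S.SatisfiesH) (i k : ℕ) :
    letI : Module R Nbar := Module.compHom Nbar (algebraMap R (Rk 0))
    Ideal.span {S.π ^ (i + 1)} • (⊤ : Submodule R (N k)) ≤ LinearMap.ker (S.πbarR hy k) := by
  letI : Module R Nbar := Module.compHom Nbar (algebraMap R (Rk 0))
  refine Submodule.smul_le.mpr fun r hr y _ => ?_
  rw [LinearMap.mem_ker, LinearMap.map_smul]
  change algebraMap R (Rk 0) r • S.πbar k y = 0
  refine S.algebraMap_smul_residual_eq_zero_of_mem hy 0 ?_ _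
  rw [hy.unif]
  exact Ideal.span_singleton_le_span_singleton.mpr (dvd_pow_self S.π (Nat.succ_ne_zero i)) hr

/-- **The presentation `T^{(k)}/π^{i+1}T^{(k)} ↠ T̄`** (`i + 1 ≤ e_k`), `R/π^{i+1}`-linear, descending `π̄_k`.
With `k = host (i+1)` its source is `D.Level (i+1)` — the refined setting's `πbar♯ i`.
[cite: Howard2004HeegnerKolyvagin, H.1 with Rem. 1.3.1 and §1.6 (arXiv p. 7 L59 and L125–127, p. 11 L33–38)] -/
def levelToResidual (S : DVRSetting p K R N Rk Nbar Nq) (hy : S.SatisfiesH) (i k : ℕ) :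
    letI := S.residualModule hy i
    (N k ⧸ Ideal.span {S.π ^ (i + 1)} • (⊤ : Submodule R (N k))) →ₗ[S.QuotRing (i + 1)] Nbar :=
  letI := S.residualModule hy i
  letI : Module R Nbar := Module.compHom Nbar (algebraMap R (Rk 0))
  { toFun := (Ideal.span {S.π ^ (i + 1)} • (⊤ : Submodule R (N k))).liftQ (S.πbarR hy k)
      (S.span_pi_pow_smul_top_le_ker_πbar hy i k)
    map_add' := fun x y => map_add _ x y
    map_smul' := fun c q => by
      obtain ⟨r, rfl⟩ := Ideal.Quotient.mk_surjective c
      obtain ⟨y, rfl⟩ := Submodule.mkQ_surjective _ q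
      change S.πbar k (r • y) = algebraMap R (Rk 0) r • S.πbar k y
      rw [← algebraMap_smul (Rk k) r y, LinearMap.map_smul, S.algebraMap_smul_residual_eq hy k 0] }

/-- `levelToResidual` on classes is `π̄_k`. [cite: Howard2004HeegnerKolyvagin, H.1 (arXiv p. 7, L59)] -/
@[simp] theorem levelToResidual_mk (S : DVRSetting p K R N Rk Nbar Nq) (hy : S.SatisfiesH) (i k : ℕ) (y : N k) :
    S.levelToResidual hy i k (Submodule.Quotient.mk y) = S.πbar k y := rfl

/-- `levelToResidual` is onto. [cite: Howard2004HeegnerKolyvagin, H.1 (arXiv p. 7, L59)] -/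
theorem levelToResidual_surjective (S : DVRSetting p K R N Rk Nbar Nq) (hy : S.SatisfiesH) (i k : ℕ) :
    Surjective (S.levelToResidual hy i k) := by
  intro x
  obtain ⟨y, rfl⟩ := (hy.h1 k).1.surjective x
  exact ⟨Submodule.Quotient.mk y, rfl⟩

/-- `levelToResidual` is `Γ_K`-equivariant for the quotient action `modIdeal` on `T^{(k)}/π^{i+1}` (= `levelRep`
on the host). [cite: Howard2004HeegnerKolyvagin, H.1 and Def. 1.1.3 (arXiv p. 7 L59, p. 5 L93–99)] -/
theorem levelToResidual_equivariant (S : DVRSetting p K R N Rk Nbar Nq) (hy : S.SatisfiesH) (i k : ℕ)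
    (σ : absoluteGaloisGroup K) (q : N k ⧸ Ideal.span {S.π ^ (i + 1)} • (⊤ : Submodule R (N k))) :
    S.levelToResidual hy i k (modIdeal (S.T.ρ k) (S.T.hlin k) (Ideal.span {S.π ^ (i + 1)}) σ q) =
      S.ρbar σ (S.levelToResidual hy i k q) := by
  obtain ⟨y, rfl⟩ := Submodule.mkQ_surjective _ q
  rw [Submodule.mkQ_apply, modIdeal_apply_mk, levelToResidual_mk, levelToResidual_mk]
  exact (hy.h1 k).1.equivariant σ y

/-- `𝔪_{R_k} = (algebraMap π)`. [cite: Howard2004HeegnerKolyvagin, §1.6 (arXiv p. 11, L33–34)] -/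
theorem maximalIdeal_levelRing (S : DVRSetting p K R N Rk Nbar Nq) (hy : S.SatisfiesH) (k : ℕ) :
    IsLocalRing.maximalIdeal (Rk k) = Ideal.span {algebraMap R (Rk k) S.π} := by
  rw [← IsLocalRing.map_maximalIdeal_of_surjective (algebraMap R (Rk k)) (hy.algebraMap_surjective k), hy.unif,
    Ideal.map_span, Set.image_singleton]

/-- **The kernel of `T^{(k)}/π^{i+1} ↠ T̄` is `𝔪 · (T^{(k)}/π^{i+1})`**, `𝔪 = (⟦π⟧)` the maximal ideal of
`R/π^{i+1}`. [cite: Howard2004HeegnerKolyvagin, H.1 (arXiv p. 7, L59: «`T̄ = T/𝔪T`»)] -/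
theorem ker_levelToResidual (S : DVRSetting p K R N Rk Nbar Nq) (hy : S.SatisfiesH) (i k : ℕ) :
    letI := S.residualModule hy i
    LinearMap.ker (S.levelToResidual hy i k) =
      Ideal.span {Ideal.Quotient.mk (Ideal.span {S.π ^ (i + 1)}) S.π} •
        (⊤ : Submodule (S.QuotRing (i + 1)) (N k ⧸ Ideal.span {S.π ^ (i + 1)} • (⊤ : Submodule R (N k)))) := by
  letI := S.residualModule hy i
  obtain ⟨hq, -, -, -⟩ := hy.h1 k
  apply le_antisymm
  · intro q hq0
    obtain ⟨y, rfl⟩ := Submodule.mkQ_surjective _ q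
    rw [LinearMap.mem_ker, Submodule.mkQ_apply, levelToResidual_mk, ← LinearMap.mem_ker, hq.ker_eq,
      S.maximalIdeal_levelRing hy k, ← mem_span_singleton_smul_top_iff_of_isScalarTower,
      Submodule.ideal_span_singleton_smul, Submodule.mem_smul_pointwise_iff_exists] at hq0
    obtain ⟨z, -, rfl⟩ := hq0
    exact Submodule.smul_mem_smul (Ideal.mem_span_singleton_self _) (Submodule.mem_top :
      (Submodule.Quotient.mk z : N k ⧸ Ideal.span {S.π ^ (i + 1)} • (⊤ : Submodule R (N k))) ∈ ⊤)
  · refine Submodule.smul_le.mpr fun c hc q _ => ?_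
    obtain ⟨c', rfl⟩ := Ideal.mem_span_singleton'.mp hc
    obtain ⟨y, rfl⟩ := Submodule.mkQ_surjective _ q
    obtain ⟨r', rfl⟩ := Ideal.Quotient.mk_surjective c'
    rw [LinearMap.mem_ker, mul_smul]
    change S.levelToResidual hy i k (Submodule.Quotient.mk (r' • S.π • y)) = 0
    rw [levelToResidual_mk, ← algebraMap_smul (Rk k) r', LinearMap.map_smul, ← algebraMap_smul (Rk k) S.π,
      LinearMap.map_smul, S.maximalIdeal_smul_residual_eq_zero_aux hy k, smul_zero]

/-- **`(T̄, levelToResidual)` presents `T̄` as the residual quotient of `T^{(k)}/π^{i+1}` over `R/π^{i+1}`** —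
the H.1 presentation of the refined level. [cite: Howard2004HeegnerKolyvagin, H.1 with Rem. 1.3.1 (arXiv p. 7 L59 and L125–127)] -/
theorem isQuotientBy_levelToResidual (S : DVRSetting p K R N Rk Nbar Nq) (hy : S.SatisfiesH) (i k : ℕ) :
    haveI := S.isLocalRing_quotRing hy (Nat.succ_pos i)
    letI := S.residualModule hy i
    IsQuotientBy (modIdeal (S.T.ρ k) (S.T.hlin k) (Ideal.span {S.π ^ (i + 1)}))
      (IsLocalRing.maximalIdeal (S.QuotRing (i + 1))) S.ρbar (S.levelToResidual hy i k) := by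
  haveI := S.isLocalRing_quotRing hy (Nat.succ_pos i)
  letI := S.residualModule hy i
  exact
    { surjective := S.levelToResidual_surjective hy i k
      ker_eq := by rw [S.ker_levelToResidual hy i k, S.maximalIdeal_quotRing hy (Nat.succ_pos i)]
      equivariant := S.levelToResidual_equivariant hy i k }

/-! ## §4 H.1 for the refined levels -/

/-- **H.1 for `T^{(k)}/π^{i+1}` over `R/π^{i+1}`** from H.1 at level `k`: the residual representation, its
carrier and its `Γ_K`-action are the same; a `Γ_K`-stable `R/π^{i+1}`-submodule of `T̄` is an `R_k`-submodule
(scalars act through representatives in `R`), and likewise for equivariant endomorphisms (Schur).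
[cite: Howard2004HeegnerKolyvagin, H.1 with Rem. 1.3.1 (arXiv p. 7 L59 and L125–127)] -/
theorem h1_quotLevel (S : DVRSetting p K R N Rk Nbar Nq) (hy : S.SatisfiesH) (i k : ℕ) :
    haveI := S.isLocalRing_quotRing hy (Nat.succ_pos i)
    letI := S.residualModule hy i
    H1 (R := S.QuotRing (i + 1)) (modIdeal (S.T.ρ k) (S.T.hlin k) (Ideal.span {S.π ^ (i + 1)})) S.ρbar
      (S.levelToResidual hy i k) := by
  haveI := S.isLocalRing_quotRing hy (Nat.succ_pos i)
  letI := S.residualModule hy i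
  obtain ⟨-, hirr, hnt, hschur⟩ := hy.h1 k
  refine ⟨S.isQuotientBy_levelToResidual hy i k, fun W hW => ?_, hnt, fun f hf => ?_⟩
  · -- transport the submodule to `R_k`
    let W' : Submodule (Rk k) Nbar :=
      { carrier := W
        add_mem' := fun ha hb => W.add_mem ha hb
        zero_mem' := W.zero_mem
        smul_mem' := fun a x hx => by
          obtain ⟨r, rfl⟩ := hy.algebraMap_surjective k a
          have h := W.smul_mem (Ideal.Quotient.mk (Ideal.span {S.π ^ (i + 1)}) r) hx
          rwa [S.mk_smul_residual hy i k r x] at h }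
    rcases hirr W' (fun σ x hx => hW σ x hx) with h | h
    · left
      rw [eq_bot_iff]
      intro x hx
      have hx' : x ∈ W' := hx
      rw [h] at hx'
      exact hx'
    · right
      rw [eq_top_iff]
      intro x _
      have hx' : x ∈ W' := by rw [h]; exact Submodule.mem_top
      exact hx'
  · let f' : Nbar →ₗ[Rk k] Nbar :=
      { toFun := f
        map_add' := fun x y => map_add f x y
        map_smul' := fun a x => by
          obtain ⟨r, rfl⟩ := hy.algebraMap_surjective k a
          rw [RingHom.id_apply, ← S.mk_smul_residual hy i k r x, LinearMap.map_smul, S.mk_smul_residual hy i k] }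
    obtain ⟨c, hc⟩ := hschur f' hf
    obtain ⟨r, rfl⟩ := hy.algebraMap_surjective k c
    exact ⟨Ideal.Quotient.mk _ r, fun x => (hc x).trans (S.mk_smul_residual hy i k r x).symm⟩

/-! ## §5 The `G_ℚ`-structure `θ` over the level rings of the refinement, H.5(a) -/

/-- All the `θ_k` agree (with `θ_0`). [cite: Howard2004HeegnerKolyvagin, H.5 (arXiv p. 7 L93 – p. 8 L1: one `θ`)] -/
theorem θ_eq_zero (S : DVRSetting p K R N Rk Nbar Nq) (hy : S.SatisfiesH) (k : ℕ) (x : Nbar) :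
    (S.A k).θ x = (S.A 0).θ x := by
  induction k with
  | zero => rfl
  | succ k ih => rw [hy.θ_eq, ih]

/-- **The `G_ℚ`-structure on `T̄` over `R/π^{i+1}`**: Howard's `θ` (the action of `τ`), re-based to the level ring
of the refinement (`θ` is `R_0`-linear, and `⟦r⟧` acts as `algebraMap R R_0 r`).
[cite: Howard2004HeegnerKolyvagin, H.5(a) with Rem. 1.3.1 (arXiv p. 7 L93–95 and L125–127)] -/
def residualTauQuot (S : DVRSetting p K R N Rk Nbar Nq) (hy : S.SatisfiesH) (i : ℕ) :
    letI := S.residualModule hy i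
    ResidualTau (R := S.QuotRing (i + 1)) S.cd S.ρbar :=
  letI := S.residualModule hy i
  { θ :=
      { toFun := (S.A 0).θ
        map_add' := fun x y => map_add _ x y
        map_smul' := fun c x => by
          obtain ⟨r, rfl⟩ := Ideal.Quotient.mk_surjective c
          rw [RingHom.id_apply, S.mk_smul_residual hy i 0, S.mk_smul_residual hy i 0, LinearMap.map_smul] }
    involutive := (S.A 0).involutive
    compat := (S.A 0).compat }

/-- Unfolding: the `θ` of the refinement is `θ_0` (= every `θ_k`). [cite: Howard2004HeegnerKolyvagin, H.5(a) (arXiv p. 7, L93–95)] -/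
@[simp] theorem residualTauQuot_θ (S : DVRSetting p K R N Rk Nbar Nq) (hy : S.SatisfiesH) (i : ℕ) (x : Nbar) :
    letI := S.residualModule hy i
    (S.residualTauQuot hy i).θ x = (S.A 0).θ x := rfl

/-- **H.5(a) for the refined levels**: the `τ`-eigenvectors of level `0` span `T̄` over `R/π^{i+1}` as well.
[cite: Howard2004HeegnerKolyvagin, H.5(a) with Rem. 1.3.1 (arXiv p. 7 L93–95 and L125–127)] -/
theorem h5a_residualTauQuot (S : DVRSetting p K R N Rk Nbar Nq) (hy : S.SatisfiesH) (i : ℕ) :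
    letI := S.residualModule hy i
    H5a (R := S.QuotRing (i + 1)) (S.residualTauQuot hy i) := by
  letI := S.residualModule hy i
  obtain ⟨xp, hxp, hθp, xm, hxm, hθm, hspan⟩ := hy.h5a 0
  refine ⟨xp, hxp, hθp, xm, hxm, hθm, fun x => ?_⟩
  obtain ⟨a, b, hab⟩ := hspan x
  obtain ⟨ra, rfl⟩ := hy.algebraMap_surjective 0 a
  obtain ⟨rb, rfl⟩ := hy.algebraMap_surjective 0 b
  exact ⟨Ideal.Quotient.mk _ ra, Ideal.Quotient.mk _ rb, hab⟩

end DVRSetting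

end Literature.NumberTheory.GaloisCohomology.Howard2004

end
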